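import Mathlib
import Literature.MathematicalPhysics.QuantumFieldTheory.MagnenRivasseauSeneor1993.MRS93GhostReintegration
import HarnessLib

/-!
# Magnen–Rivasseau–Sénéor (CMP 155, 1993): the finite-dimensional reading (FD) of the Gaussian measures `dν_{ρ₂}(γ)`
# (II.36) and `dμ_{0,ρ₁}(A)` (II.18) IS the tree's measure on every finite window of positive-momentum modes — PROVED:
# `∫ G(γ|_W) dν_{ρ₂}(γ) = Z⁻¹∫ e^{−½yᵀdiag(Γ_{ρ₂}⁻¹)y} G(y) dy`

statement-level skeleton of published definitions with citation tags; bookkeeping proved; nothing here is a claim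
about the Yang–Mills mass gap, about continuum Yang–Mills on `T⁴` without infrared cutoff, or about the Clay problem —
and nothing of Magnen–Rivasseau–Sénéor's analysis (expansions, bounds, limits) is asserted or formalised

**Citation header (reproduction of PUBLISHED work).** J. Magnen, V. Rivasseau, R. Sénéor, *Construction of YM₄ with
an infrared cutoff*, Commun. Math. Phys. **155** (1993) 325–383 [MagnenRivasseauSeneor1993]: (II.17)–(II.18) p.332
tl.5–21 («dμ_{0,ρ₁} is the Gaussian measure with propagator C₀(p)κ_{ρ₁}(p)»), (II.36) p.339 tl.22–24 («The Gaussian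
measure on γ with covariance Γ_{ρ₂} is called dν_{ρ₂}(γ)»), and the finite-dimensional Gaussian manipulations of
(II.44) p.341 and (II.71)–(II.73) p.345 («by completing the square»). Loci `p.NNN tl.nn` = journal page / text-layer
line of the held scan `paper:magnen1993-cmp155-mrs-ym4-infrared-cutoff`. Cell pub-balaban-gaps, track G3, seat
mrs-lit-1 (gen 6); companion prose `run/shared/lean/pub/pub-balaban-gaps/g3/MRS-AS-PRINTED.md` §2, §5. Builds on
`…MRS93GhostReintegration` (gen 6: `GhostGaussian.gaussZ`, `gaussExpect` — READING (FD)) and, through it,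
`…MRS93GaussianReferenceMeasures` (gen 2: `modeGaussian` = `⊗_m 𝒩(0, v_m)` (Mathlib `Measure.infinitePi`),
`realify`, `gaussianFieldLaw`, `muZero` = `dμ_{0,ρ₁}`, `nu` = `dν_{ρ₂}`, `Momentum.IsPos`).

**Why this file.** `…MRS93GhostReintegration` ((II.71)–(II.77)) and `…MRS93GaussianChangeOfVariables` ((II.44)/(II.45))
prove the print's Gaussian manipulations in a DECLARED finite-dimensional reading (FD): «`dν_{ρ₂}` restricted to the
finitely many window coordinates is the normalised Gaussian `gaussExpect Γ⁻¹`». This file PROVES that reading for the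
tree's actual measures: on every finite window `W` of POSITIVE-momentum modes (the independent real coordinates of the
realified field; the modes at `−p` are their `±` copies) with positive variances, integrating any measurable function
of the window coordinates against `dν_{ρ₂}` (resp. `dμ_{0,ρ₁}`) IS `gaussExpect diag(v|_W⁻¹)` with `v` the tree's mode
variances (`Γ_{ρ₂}(|p|)`, resp. `C₀(p)κ_{ρ₁}(p)`).

**What is typed here (bookkeeping kernel-checked, zero `sorry`, zero named facts).**
* §1 (sub-namespace `MainStatement.GhostGaussian`) **independent Gaussian modes = the (FD) Gaussian with diagonal
  `Γ⁻¹`**: `diagInv v = diag(v⁻¹)`; `prod_gaussianPDFReal_eq` (`Π_i gaussianPDF(0,v_i)(y_i) = (Π_i(2πv_i)^{−1/2})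
  e^{−½yᵀdiag(v⁻¹)y}`); **`gaussZ_diagInv`** (`Z(diag v⁻¹) = Π_i √(2πv_i)` — Fubini + the one-dimensional Gaussian
  integral); **`pi_gaussianReal_eq_withDensity`** (`⊗_i 𝒩(0,v_i) = (Π_i gaussianPDF(0,v_i))·Lebesgue` on `ι → ℝ`, PROVED
  by Mathlib's characterisation `Measure.pi_eq` on boxes + Fubini for the box integrals); **`integral_pi_gaussianReal`**
  (`∫ G d(⊗_i 𝒩(0,v_i)) = gaussExpect (diag v⁻¹) G` for EVERY `G`).
* §2 **the tree's measures**: **`integral_modeGaussian_window`** (`∫ G(X|_W) d(modeGaussian v) = gaussExpect diag(v|_W⁻¹) G`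
  for a finite set `W` of modes with positive variances and measurable `G` — Mathlib's projective-limit property
  `Measure.infinitePi_map_restrict`); `realify_apply_of_isPos` (realification is the identity on positive-momentum
  modes); **`integral_gaussianFieldLaw_window`** (the same for the realified law on windows of POSITIVE modes);
  **`integral_nu_window`** (`dν_{ρ₂}`: `Γ⁻¹ = diag(nuVariance|_W⁻¹)`) and **`integral_muZero_window`** (`dμ_{0,ρ₁}`: `C⁻¹ =
  diag(muZeroVariance|_W⁻¹)`); and for ARBITRARY finite windows (momenta of both signs): `realifyWindow` (the window
  coordinates as the `±` image of the independent coordinates at the representatives `rep(W)`), `measurable_realifyWindow`,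
  `restrict_realify`, **`integral_gaussianFieldLaw_window_rep`** (`∫ G(A|_W) = gaussExpect diag(v|_{rep W}⁻¹) (G ∘ realifyWindow)`),
  **`integral_nu_window_rep`**, **`integral_muZero_window_rep`**.

**Readings / scope (declared).** The Gaussian `gaussExpect` always lives on INDEPENDENT coordinates: for a window of
POSITIVE-momentum modes (`Momentum.IsPos`) these are the window coordinates themselves; for an arbitrary finite window
they are the coordinates at the representatives `rep(W)` (positive momenta) and the window is their `±` image
(`realifyWindow`; for a real field the coordinates at `−p` are `±` those at `p`, `realify`) — the window covariance of
a window mixing `p` and `−p` is singular and the print's `Γ⁻¹` does not exist there, so no statement with `Γ⁻¹` on such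
a window is made. NON-ZERO variances on the (representative) window (`Γ_{ρ₂}(|p|) > 0`: ghost modes below the cutoff
`ρ₂`; `C₀κ_{ρ₁} > 0`: live, non-time modes below `(3+η⁻¹)M^{ρ₁}`) — exactly the modes the print integrates; dead modes
(variance `0`, Dirac at `0`) are outside the statement. `G` measurable (real-valued).

**Honest status / what is NOT claimed.** This is measure-theoretic bookkeeping identifying two descriptions of the
same finite-dimensional Gaussian; it asserts nothing of MRS's analysis, nothing about the density factors of (II.78),
nothing about normalisability, limits, or bounds. Nothing here bears on Bałaban's papers; nothing is continuum YM₄ on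
`T⁴`, nothing lifts the infrared cutoff, nothing is Clay.
-/

noncomputable section

open MeasureTheory Finset
open scoped NNReal ENNReal Matrix

namespace Literature.MathematicalPhysics.QuantumFieldTheory.MagnenRivasseauSeneor1993

namespace MainStatement

namespace GhostGaussian

open ProbabilityTheory

variable {ι : Type*} [Fintype ι] [DecidableEq ι]

/-! ## §1 Independent Gaussian modes with variances `v`: the (FD) inverse propagator is `diag(1/v)` -/

/-- `Γ⁻¹` (resp. `C⁻¹`) for INDEPENDENT modes of variances `v_i`: the diagonal matrix `diag(v_i⁻¹)`.
[cite: MagnenRivasseauSeneor1993, (II.36) p.339 tl.22–24, (II.18) p.332 tl.16–21] -/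
def diagInv (v : ι → ℝ≥0) : Matrix ι ι ℝ := Matrix.diagonal fun i => ((v i : ℝ))⁻¹

omit [DecidableEq ι] in
/-- Independent one-dimensional Gaussian densities multiply to the (FD) Gaussian weight:
`Π_i (2πv_i)^{−1/2} e^{−y_i²/(2v_i)} = (Π_i (2πv_i)^{−1/2}) · e^{−½ yᵀ diag(v⁻¹) y}`.
[cite: MagnenRivasseauSeneor1993, (II.36) p.339, (II.17)–(II.18) p.332] -/
theorem prod_gaussianPDFReal_eq [DecidableEq ι] (v : ι → ℝ≥0) (y : ι → ℝ) :
    ∏ i, gaussianPDFReal 0 (v i) (y i) =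
      (∏ i, (Real.sqrt (2 * Real.pi * v i))⁻¹) * Real.exp (-(1 / 2 : ℝ) * (y ⬝ᵥ (diagInv v *ᵥ y))) := by
  simp only [gaussianPDFReal, sub_zero]
  rw [Finset.prod_mul_distrib, ← Real.exp_sum]
  congr 2
  unfold diagInv dotProduct
  rw [Finset.mul_sum]
  refine Finset.sum_congr rfl fun i _ => ?_
  rw [Matrix.mulVec_diagonal]
  ring

/-- `Z(diag(v⁻¹)) = Π_i √(2πv_i)` — the product of the one-dimensional normalisations (Fubini + `∫e^{−y²/(2v)} = √(2πv)`).
[cite: MagnenRivasseauSeneor1993, (II.36) p.339, (II.73) p.345] -/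
theorem gaussZ_diagInv (v : ι → ℝ≥0) (hv : ∀ i, v i ≠ 0) :
    gaussZ (diagInv v) = ∏ i, Real.sqrt (2 * Real.pi * v i) := by
  have h : ∀ y : ι → ℝ, Real.exp (-(1 / 2 : ℝ) * (y ⬝ᵥ (diagInv v *ᵥ y))) =
      ∏ i, Real.exp (-(2 * (v i : ℝ))⁻¹ * y i ^ 2) := by
    intro y
    rw [← Real.exp_sum]
    congr 1
    unfold diagInv dotProduct
    rw [Finset.mul_sum]
    refine Finset.sum_congr rfl fun i _ => ?_
    rw [Matrix.mulVec_diagonal]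
    ring
  unfold gaussZ
  simp_rw [h]
  rw [integral_fintype_prod_volume_eq_prod (fun i (t : ℝ) => Real.exp (-(2 * (v i : ℝ))⁻¹ * t ^ 2))]
  refine Finset.prod_congr rfl fun i _ => ?_
  rw [integral_gaussian]
  congr 1
  have : (v i : ℝ) ≠ 0 := NNReal.coe_ne_zero.mpr (hv i)
  field_simp

omit [DecidableEq ι] in
/-- **The finite product of Mathlib Gaussians IS the (FD) normalised Gaussian density**: `⊗_i 𝒩(0, v_i) =
(Π_i gaussianPDF(0, v_i)) · Lebesgue` on `ι → ℝ` (characterisation of `Measure.pi` on boxes, Fubini for the box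
integrals). [cite: MagnenRivasseauSeneor1993, (II.17)–(II.18) p.332, (II.36) p.339] -/
theorem pi_gaussianReal_eq_withDensity (v : ι → ℝ≥0) (hv : ∀ i, v i ≠ 0) :
    Measure.pi (fun i => gaussianReal 0 (v i)) =
      (volume : Measure (ι → ℝ)).withDensity (fun y => ENNReal.ofReal (∏ i, gaussianPDFReal 0 (v i) (y i))) := by
  refine Measure.pi_eq fun s hs => ?_
  rw [withDensity_apply _ (MeasurableSet.univ_pi hs), ← lintegral_indicator (MeasurableSet.univ_pi hs)]
  have hind : ∀ y : ι → ℝ, (Set.pi Set.univ s).indicator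
      (fun y => ENNReal.ofReal (∏ i, gaussianPDFReal 0 (v i) (y i))) y =
      ENNReal.ofReal (∏ i, (s i).indicator (gaussianPDFReal 0 (v i)) (y i)) := by
    intro y
    by_cases hy : y ∈ Set.pi Set.univ s
    · rw [Set.indicator_of_mem hy]
      congr 1
      refine Finset.prod_congr rfl fun i _ => ?_
      rw [Set.indicator_of_mem (hy i (Set.mem_univ i))]
    · rw [Set.indicator_of_notMem hy]
      obtain ⟨i, hi⟩ : ∃ i, y i ∉ s i := by
        by_contra h
        push Not at h
        exact hy fun i _ => h i
      rw [Finset.prod_eq_zero (Finset.mem_univ i) (Set.indicator_of_notMem hi _), ENNReal.ofReal_zero]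
  simp_rw [hind]
  have hint : Integrable (fun y : ι → ℝ => ∏ i, (s i).indicator (gaussianPDFReal 0 (v i)) (y i)) volume :=
    Integrable.fintype_prod (μ := fun _ : ι => (volume : Measure ℝ))
      fun i => (integrable_gaussianPDFReal 0 (v i)).indicator (hs i)
  have hnn : 0 ≤ᵐ[volume] fun y : ι → ℝ => ∏ i, (s i).indicator (gaussianPDFReal 0 (v i)) (y i) :=
    Filter.Eventually.of_forall fun y => Finset.prod_nonneg fun i _ =>
      Set.indicator_nonneg (fun _ _ => gaussianPDFReal_nonneg _ _ _) _
  rw [← ofReal_integral_eq_lintegral_ofReal hint hnn,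
    integral_fintype_prod_volume_eq_prod (fun i => (s i).indicator (gaussianPDFReal 0 (v i))),
    ENNReal.ofReal_prod_of_nonneg fun i _ => integral_nonneg fun _ =>
      Set.indicator_nonneg (fun _ _ => gaussianPDFReal_nonneg _ _ _) _]
  refine Finset.prod_congr rfl fun i _ => ?_
  rw [integral_indicator (hs i), gaussianReal_apply_eq_integral _ (hv i)]

/-- **Integration against independent Gaussian modes IS the (FD) normalised Gaussian expectation**:
`∫ G d(⊗_i 𝒩(0, v_i)) = Z(diag v⁻¹)⁻¹ ∫ e^{−½yᵀdiag(v⁻¹)y} G(y) dy = gaussExpect (diag v⁻¹) G` — for EVERY `G`.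
[cite: MagnenRivasseauSeneor1993, (II.36) p.339, (II.73) p.345] -/
theorem integral_pi_gaussianReal (v : ι → ℝ≥0) (hv : ∀ i, v i ≠ 0) (G : (ι → ℝ) → ℝ) :
    ∫ y, G y ∂(Measure.pi fun i => gaussianReal 0 (v i)) = gaussExpect (diagInv v) G := by
  rw [pi_gaussianReal_eq_withDensity v hv,
    integral_withDensity_eq_integral_toReal_smul₀
      ((Measurable.ennreal_ofReal (by fun_prop))).aemeasurable
      (Filter.Eventually.of_forall fun _ => ENNReal.ofReal_lt_top)]
  simp_rw [ENNReal.toReal_ofReal (Finset.prod_nonneg fun i _ => gaussianPDFReal_nonneg _ _ _),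
    prod_gaussianPDFReal_eq v, gaussExpect, gaussZ_diagInv v hv, smul_eq_mul]
  rw [← integral_const_mul]
  congr 1
  funext y
  have hc : (∏ i, (Real.sqrt (2 * Real.pi * v i))⁻¹) = (∏ i, Real.sqrt (2 * Real.pi * v i))⁻¹ := by
    rw [Finset.prod_inv_distrib]
  rw [hc]
  ring

end GhostGaussian

/-! ## §2 The tree's reference measures: integrating a function of finitely many POSITIVE-momentum modes against
`modeGaussian` / the realified `gaussianFieldLaw` (hence `dν_{ρ₂}`, `dμ_{0,ρ₁}`) IS `gaussExpect` with `Γ⁻¹ = diag(1/variance)` -/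

section window

open ProbabilityTheory

variable {L : Type*} [DecidableEq L]

/-- **The window marginal of the tree's independent-mode Gaussian is the (FD) Gaussian**: for a finite set `W` of modes
with positive variances and every measurable `G` of the window coordinates,
`∫ G(X|_W) d(modeGaussian v)(X) = gaussExpect diag(v|_W⁻¹) G` (Mathlib: the projective-limit property of
`Measure.infinitePi` + §1). [cite: MagnenRivasseauSeneor1993, (II.36) p.339, (II.17)–(II.18) p.332] -/
theorem integral_modeGaussian_window (v : Momentum × L → ℝ≥0) (W : Finset (Momentum × L))
    (hv : ∀ m : W, v m ≠ 0) {G : (W → ℝ) → ℝ} (hG : Measurable G) :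
    ∫ X, G (W.restrict X) ∂(modeGaussian v) = GhostGaussian.gaussExpect (GhostGaussian.diagInv fun m : W => v m) G := by
  have hmap : (modeGaussian v).map W.restrict = Measure.pi fun m : W => gaussianReal 0 (v m) := by
    unfold modeGaussian
    exact Measure.infinitePi_map_restrict _
  calc ∫ X, G (W.restrict X) ∂(modeGaussian v)
      = ∫ y, G y ∂((modeGaussian v).map W.restrict) :=
        (integral_map (Finset.measurable_restrict W).aemeasurable hG.aestronglyMeasurable).symm
    _ = ∫ y, G y ∂(Measure.pi fun m : W => gaussianReal 0 (v m)) := by rw [hmap]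
    _ = _ := GhostGaussian.integral_pi_gaussianReal (fun m : W => v m) hv G

omit [DecidableEq L] in
/-- On POSITIVE-momentum modes realification is the identity: `(realify X)(m) = X(m)` if `m.1` is positive.
[cite: MagnenRivasseauSeneor1993, §II.A p.328 tl.12–17] -/
theorem realify_apply_of_isPos (im : L → Bool) (X : Momentum × L → ℝ) {m : Momentum × L} (hm : m.1.IsPos) :
    realify im X m = X m := by
  unfold realify sgn rep
  rw [if_pos hm, if_pos hm, one_mul]

/-- **The same for the realified field law** (`gaussianFieldLaw`, of which `dμ_{0,ρ₁} = muZero`, `dν_{ρ₂} = nu` are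
instances): for a window `W` of POSITIVE-momentum modes (the independent coordinates; the modes at `−p` are their `±`
copies) with positive variances, `∫ G(A|_W) d(gaussianFieldLaw im v)(A) = gaussExpect diag(v|_W⁻¹) G`.
[cite: MagnenRivasseauSeneor1993, (II.17)–(II.18) p.332, (II.36) p.339, §II.A p.328 tl.12–17] -/
theorem integral_gaussianFieldLaw_window (im : L → Bool) (v : Momentum × L → ℝ≥0) (W : Finset (Momentum × L))
    (hW : ∀ m ∈ W, m.1.IsPos) (hv : ∀ m : W, v m ≠ 0) {G : (W → ℝ) → ℝ} (hG : Measurable G) :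
    ∫ A, G (W.restrict A) ∂(gaussianFieldLaw im v) =
      GhostGaussian.gaussExpect (GhostGaussian.diagInv fun m : W => v m) G := by
  unfold gaussianFieldLaw
  rw [integral_map (f := fun A => G (W.restrict A)) (measurable_realify im).aemeasurable
    (hG.comp (Finset.measurable_restrict W)).aestronglyMeasurable]
  have h : ∀ X : Momentum × L → ℝ, W.restrict (realify im X) = W.restrict X := by
    intro X
    funext m
    exact realify_apply_of_isPos im X (hW m m.2)
  simp_rw [h]
  exact integral_modeGaussian_window v W hv hG

/-- **`dν_{ρ₂}(γ)` on a window of positive ghost modes below the cutoff IS READING (FD)'s Gaussian with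
`Γ⁻¹ = diag(Γ_{ρ₂}(|p|)⁻¹)`**: `∫ G(γ|_W) dν_{ρ₂}(γ) = gaussExpect diag((nuVariance ρ₂)|_W⁻¹) G`.
[cite: MagnenRivasseauSeneor1993, (II.36) p.339 tl.22–24, (II.55)/(II.66) p.343–344] -/
theorem integral_nu_window (par : Parameters) (ρ₂ : ℕ) (W : Finset GhostMode) (hW : ∀ m ∈ W, m.1.IsPos)
    (hv : ∀ m : W, par.nuVariance ρ₂ m ≠ 0) {G : (W → ℝ) → ℝ} (hG : Measurable G) :
    ∫ γ, G (W.restrict γ) ∂(nu par ρ₂) =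
      GhostGaussian.gaussExpect (GhostGaussian.diagInv fun m : W => par.nuVariance ρ₂ m) G :=
  integral_gaussianFieldLaw_window ghostIm (par.nuVariance ρ₂) W hW hv hG

/-- **`dμ_{0,ρ₁}(A)` likewise** (`C⁻¹ = diag((C₀κ_{ρ₁})(|p|)⁻¹)` on a window of positive, live modes).
[cite: MagnenRivasseauSeneor1993, (II.18) p.332 tl.16–21, (II.44) p.341] -/
theorem integral_muZero_window (par : Parameters) (ρ₁ : ℕ) (W : Finset Mode) (hW : ∀ m ∈ W, m.1.IsPos)
    (hv : ∀ m : W, par.muZeroVariance ρ₁ m ≠ 0) {G : (W → ℝ) → ℝ} (hG : Measurable G) :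
    ∫ A, G (W.restrict A) ∂(muZero par ρ₁) =
      GhostGaussian.gaussExpect (GhostGaussian.diagInv fun m : W => par.muZeroVariance ρ₁ m) G :=
  integral_gaussianFieldLaw_window modeIm (par.muZeroVariance ρ₁) W hW hv hG

/-! ### General finite windows: reading the realified field through the representatives `rep W` -/

/-- Realification read on a finite window `W`: from independent coordinates on the representatives `rep(W)` to the
window coordinates, `y ↦ (m ↦ sgn(m)·y(rep m))`. [cite: MagnenRivasseauSeneor1993, §II.A p.328 tl.12–17] -/
def realifyWindow (im : L → Bool) (W : Finset (Momentum × L)) (y : ↥(W.image rep) → ℝ) : W → ℝ :=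
  fun m => sgn im m * y ⟨rep m, Finset.mem_image_of_mem rep m.2⟩

omit [DecidableEq L] in
/-- `realifyWindow` is measurable (each coordinate is `±` an input coordinate). [cite: MagnenRivasseauSeneor1993, §II.A p.328] -/
theorem measurable_realifyWindow [DecidableEq L] (im : L → Bool) (W : Finset (Momentum × L)) :
    Measurable (realifyWindow im W) := by
  refine measurable_pi_lambda _ fun m => ?_
  exact Measurable.mul measurable_const (measurable_pi_apply _)

/-- The window of a realified configuration is `realifyWindow` of the representatives' window.
[cite: MagnenRivasseauSeneor1993, §II.A p.328 tl.12–17] -/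
theorem restrict_realify (im : L → Bool) (W : Finset (Momentum × L)) (X : Momentum × L → ℝ) :
    W.restrict (realify im X) = realifyWindow im W ((W.image rep).restrict X) := by
  funext m
  rfl

/-- **Any finite window of the realified field law** (momenta of both signs allowed): `∫ G(A|_W) d(gaussianFieldLaw im v)
= gaussExpect diag(v|_{rep W}⁻¹) (G ∘ realifyWindow)` — the Gaussian lives on the independent coordinates at the
representatives `rep(W)` (positive momenta), the window is their `±` image. Non-zero variances on `rep(W)`, `G` measurable.
[cite: MagnenRivasseauSeneor1993, §II.A p.328 tl.12–17, (II.18) p.332, (II.36) p.339] -/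
theorem integral_gaussianFieldLaw_window_rep (im : L → Bool) (v : Momentum × L → ℝ≥0) (W : Finset (Momentum × L))
    (hv : ∀ m : ↥(W.image rep), v m ≠ 0) {G : (W → ℝ) → ℝ} (hG : Measurable G) :
    ∫ A, G (W.restrict A) ∂(gaussianFieldLaw im v) =
      GhostGaussian.gaussExpect (GhostGaussian.diagInv fun m : ↥(W.image rep) => v m)
        (fun y => G (realifyWindow im W y)) := by
  unfold gaussianFieldLaw
  rw [integral_map (f := fun A => G (W.restrict A)) (measurable_realify im).aemeasurable
    (hG.comp (Finset.measurable_restrict W)).aestronglyMeasurable]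
  simp_rw [restrict_realify]
  exact integral_modeGaussian_window v (W.image rep) hv (hG.comp (measurable_realifyWindow im W))

/-- **`dν_{ρ₂}` on ANY finite window of ghost modes** (both signs of momenta): `∫ G(γ|_W) dν_{ρ₂}(γ) =
gaussExpect diag((nuVariance ρ₂)|_{rep W}⁻¹) (G ∘ realifyWindow)`. [cite: MagnenRivasseauSeneor1993, (II.36) p.339 tl.22–24] -/
theorem integral_nu_window_rep (par : Parameters) (ρ₂ : ℕ) (W : Finset GhostMode)
    (hv : ∀ m : ↥(W.image rep), par.nuVariance ρ₂ m ≠ 0) {G : (W → ℝ) → ℝ} (hG : Measurable G) :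
    ∫ γ, G (W.restrict γ) ∂(nu par ρ₂) =
      GhostGaussian.gaussExpect (GhostGaussian.diagInv fun m : ↥(W.image rep) => par.nuVariance ρ₂ m)
        (fun y => G (realifyWindow ghostIm W y)) :=
  integral_gaussianFieldLaw_window_rep ghostIm (par.nuVariance ρ₂) W hv hG

/-- **`dμ_{0,ρ₁}` on ANY finite window of modes** likewise. [cite: MagnenRivasseauSeneor1993, (II.18) p.332 tl.16–21] -/
theorem integral_muZero_window_rep (par : Parameters) (ρ₁ : ℕ) (W : Finset Mode)
    (hv : ∀ m : ↥(W.image rep), par.muZeroVariance ρ₁ m ≠ 0) {G : (W → ℝ) → ℝ} (hG : Measurable G) :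
    ∫ A, G (W.restrict A) ∂(muZero par ρ₁) =
      GhostGaussian.gaussExpect (GhostGaussian.diagInv fun m : ↥(W.image rep) => par.muZeroVariance ρ₁ m)
        (fun y => G (realifyWindow modeIm W y)) :=
  integral_gaussianFieldLaw_window_rep modeIm (par.muZeroVariance ρ₁) W hv hG

end window


end MainStatement

end Literature.MathematicalPhysics.QuantumFieldTheory.MagnenRivasseauSeneor1993
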